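import Summits.RiemannHypothesis.RiemannHypothesis.Theses.EarlyAppointments
import Literature.Analysis.Complex.JensenCircles
import Literature.Analysis.Complex.FourierPolyaKiKimEngine

/-!
# Birth skeleton (BC3) for crux `LogCombLandingLaw` — route `EarlyAppointments`, item stmt-RiemannHypothesis-3183

Line `birth`: the crux's own mechanism ("landing produces the non-Laguerre point"), cut at its one
clean seam.  `LogCombLandingLaw` says: every non-real zero `z₀` of a log-comb function `f` books a
non-Laguerre critical point of some real derivative `fℝ^{(k)}` with `k ≤ C log²(‖z₀‖+3)` and
`|x − Re z₀| ≤ C log²(‖z₀‖+3)`.  We split it as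

* `stub_landing` (**LANDED BOX**, the quantitative heart = iterated comb descent + depth bound +
  box selection): within `C(A) log²` differentiations and `C(A) log²` of `Re z₀` there is a level `k`
  and a box `B = [α,β] × [−Y,Y]` such that `g = f^{(k)}` still has a non-real zero inside `B`,
  `g' = f^{(k+1)}` has only real zeros in `B` (the lineage has LANDED), `g, g' ≠ 0` at the two real
  corners, and the logarithmic field points DOWN on the upper half-boundary (`Im g'/g < 0`);
* `stub_boxFourierPolya` (**LOCAL FOURIER–PÓLYA COUNT ON A BOX**, pure function theory): such a
  configuration forces a non-Laguerre critical point of `Re g|ℝ` in `(α, β)` — argument principle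
  for `g'/g` on `∂B` (`wind = N_B(g') − N_B(g) = (s(α) − s(β))/2`, `s = sign (g g')`) against the
  Fourier–Hurwitz count on `[α, β]` (`fourK = 2N(g') − 2N(g) − (s(α) − s(β)) = 4·#{non-real zeros
  of g in B, Im > 0} ≥ 4`, hence a critical zero: `Literature.Analysis.Complex.KiKim.fourK_nonneg_dvd_iff`,
  `Literature.Analysis.Complex.integral_boundary_rect_logDeriv`, `integral_logDeriv_horizontal/vertical`).
  This is the route's support item `LocalFourierPolya` (stmt-3185) with the box sides NOT required
  to pass through zeros of `g` (needed: comb-free members of the class, e.g. `f = z² + 1 ∈ class(A)`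
  for `A ≥ 1/2` with `a = b = 0`, have no real zeros to put the sides through, yet satisfy the law
  at `k = 0`, `x = 0`).

`LogCombLandingLaw_of : Sig.stub_landing → Sig.stub_boxFourierPolya → LogCombLandingLaw` is the real composition
(instantiate the box count at `g = f^{(k)}`, then move between `t ↦ Re f^{(j)}(t)` and
`(Re f|ℝ)^{(j)}` with the PROVED bridges `Literature.Analysis.Complex.KiKim.iteratedDeriv_re_ofReal`,
`im_iteratedDeriv_ofReal`, `differentiable_iteratedDeriv_of_entire`); `LogCombLandingLaw_proof`
feeds it the two sorried stubs.  Sorries: exactly `stub_landing`, `stub_boxFourierPolya`.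

Tree facts the stub provers should start from (all PROVED): Jensen's theorem for order `< 2`
(`Literature.Analysis.Complex.jensen_circle`, `jensen_circle_pos`), heredity of the class under
`d/dz` (`exists_growth_iteratedDeriv`, `abs_im_le_of_iteratedDeriv_eq_zero`), the pair sign
identity (`im_mul_im_div_sub_add_div_sub_conj`, `im_mul_im_pair_le`) and the two-point expansion
`exists_logDeriv_eq_sum_pair` (gives `Im g'/g < 0` off the Jensen discs, in particular on
`Im z > 1`), the argument principle on rectangles (`ArgumentPrincipleRectangle.lean`), the
Fourier–Hurwitz–Ki–Kim counting calculus (`FourierPolyaKiKimCounting.lean`: `fourK`, `zeroCount`).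
Note for the route planner: the QUALITATIVE form of the crux (some non-Laguerre point at some
level, no localisation) is Ki–Kim 2000 Thm 4.3, PROVED in tree as
`Literature.Analysis.Complex.KiKim2000_thm_4_3_noCriticalPoints_holds`; the crux's content is the
`C log²` localisation in depth and abscissa, carried entirely by `stub_landing`.
Disproof used: none on file for this crux (no `Cruxes/LogCombLandingLaw/Disproof.lean` yet).
-/

namespace Summit.RiemannHypothesis.RiemannHypothesis.Cruxes.LogCombLandingLaw.Birth

open Summit.RiemannHypothesis.RiemannHypothesis.Theses.EarlyAppointments (LogCombLandingLaw)

/-! ## The two stub statements as named propositions `Sig.stub_*` (the hypotheses of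
`LogCombLandingLaw_of`; same short names as the registered stubs, so the skeleton audit admits them) -/

namespace Sig

/-- **Stub 1 (LANDED BOX).** For every `A` there is `C` such that for every log-comb function `f`
(hypotheses verbatim those of `LogCombLandingLaw`) and every non-real zero `z` of `f` there are a
level `k ≤ C log²(‖z‖+3)`, abscissae `α < β` within `C log²(‖z‖+3)` of `Re z` and a height `Y > 0`
with: `f^{(k)}(α), f^{(k)}(β), f^{(k+1)}(α), f^{(k+1)}(β) ≠ 0`; `f^{(k)}` has a non-real zero `w` with
`α < Re w < β`, `|Im w| < Y`; every zero of `f^{(k+1)}` in `[α,β] × [−Y,Y]` is real; and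
`Im (f^{(k+1)}/f^{(k)}) < 0` on the top edge `Im u = Y, α ≤ Re u ≤ β` and on the upper sides
`Re u ∈ {α, β}, 0 < Im u ≤ Y`.  (The bet of the crux: depth and drift `O(log²)`.) -/
def stub_landing : Prop :=
  ∀ A : ℝ, ∃ C : ℝ, ∀ (f : ℂ → ℂ) (a b : ℝ), Literature.Analysis.Complex.IsEntireOfOrderLt 2 f →
    Literature.Analysis.Complex.IsRealOnReal f → (∀ z : ℂ, f (-z) = f z) →
    Literature.Analysis.Complex.RootsInStrip f 1 → 0 ≤ a → a ≤ A → |b| ≤ A →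
    (∀ z : ℂ, 5 ≤ z.im → ‖deriv f z / f z + Complex.I * ((a * Real.log (‖z‖ + 3) + b : ℝ) : ℂ)‖ ≤ A) →
    ∀ z : ℂ, f z = 0 → z.im ≠ 0 →
    ∃ (k : ℕ) (α β Y : ℝ), (k : ℝ) ≤ C * Real.log (‖z‖ + 3) ^ 2 ∧
      |α - z.re| ≤ C * Real.log (‖z‖ + 3) ^ 2 ∧ |β - z.re| ≤ C * Real.log (‖z‖ + 3) ^ 2 ∧
      α < β ∧ 0 < Y ∧
      iteratedDeriv k f (α : ℂ) ≠ 0 ∧ iteratedDeriv k f (β : ℂ) ≠ 0 ∧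
      deriv (iteratedDeriv k f) (α : ℂ) ≠ 0 ∧ deriv (iteratedDeriv k f) (β : ℂ) ≠ 0 ∧
      (∃ w : ℂ, iteratedDeriv k f w = 0 ∧ α < w.re ∧ w.re < β ∧ 0 < |w.im| ∧ |w.im| < Y) ∧
      (∀ w : ℂ, deriv (iteratedDeriv k f) w = 0 → α ≤ w.re → w.re ≤ β → |w.im| ≤ Y → w.im = 0) ∧
      (∀ u : ℂ, ((u.im = Y ∧ α ≤ u.re ∧ u.re ≤ β) ∨ ((u.re = α ∨ u.re = β) ∧ 0 < u.im ∧ u.im ≤ Y)) →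
        (deriv (iteratedDeriv k f) u / iteratedDeriv k f u).im < 0)

/-- **Stub 2 (LOCAL FOURIER–PÓLYA COUNT ON A BOX).** Let `g` be entire and real on `ℝ`, `α < β`,
`Y > 0`, with `g(α), g(β), g'(α), g'(β) ≠ 0`.  If `g` has a non-real zero `w` with `α < Re w < β`,
`|Im w| < Y`, every zero of `g'` in `[α,β] × [−Y,Y]` is real, and `Im (g'/g) < 0` on the top edge and
the upper sides of the box, then some `x ∈ (α, β)` is a non-Laguerre critical point of
`gℝ = Re g|ℝ`: `gℝ'(x) = 0`, `gℝ(x) ≠ 0`, `gℝ(x) gℝ''(x) ≥ 0`.  (Sides through zeros of `g` is the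
route's `LocalFourierPolya`; here the sides avoid the zeros and the corner signs `sign (g g')(α), (β)`
enter the count: `wind(g'/g, ∂B) = (s(α) − s(β))/2` while `fourK = 2(N(g') − N(g)) − (s(α) − s(β))`.) -/
def stub_boxFourierPolya : Prop :=
  ∀ (g : ℂ → ℂ) (α β Y : ℝ), Differentiable ℂ g → (∀ x : ℝ, (g (x : ℂ)).im = 0) → α < β → 0 < Y →
    g (α : ℂ) ≠ 0 → g (β : ℂ) ≠ 0 → deriv g (α : ℂ) ≠ 0 → deriv g (β : ℂ) ≠ 0 →
    (∃ w : ℂ, g w = 0 ∧ α < w.re ∧ w.re < β ∧ 0 < |w.im| ∧ |w.im| < Y) →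
    (∀ w : ℂ, deriv g w = 0 → α ≤ w.re → w.re ≤ β → |w.im| ≤ Y → w.im = 0) →
    (∀ u : ℂ, ((u.im = Y ∧ α ≤ u.re ∧ u.re ≤ β) ∨ ((u.re = α ∨ u.re = β) ∧ 0 < u.im ∧ u.im ≤ Y)) →
      (deriv g u / g u).im < 0) →
    ∃ x : ℝ, α < x ∧ x < β ∧ deriv (fun t : ℝ => (g (t : ℂ)).re) x = 0 ∧ (g (x : ℂ)).re ≠ 0 ∧
      0 ≤ (g (x : ℂ)).re * iteratedDeriv 2 (fun t : ℝ => (g (t : ℂ)).re) x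

end Sig

/-! ## The registered stubs (full signatures; `sorry` lives only here) -/

/-- Registered stub `stub_landing` (= `Sig.stub_landing`, spelled out so that a `Theorems/` proof can
restate it verbatim over importable declarations). -/
theorem stub_landing :
    ∀ A : ℝ, ∃ C : ℝ, ∀ (f : ℂ → ℂ) (a b : ℝ), Literature.Analysis.Complex.IsEntireOfOrderLt 2 f →
    Literature.Analysis.Complex.IsRealOnReal f → (∀ z : ℂ, f (-z) = f z) →
    Literature.Analysis.Complex.RootsInStrip f 1 → 0 ≤ a → a ≤ A → |b| ≤ A →
    (∀ z : ℂ, 5 ≤ z.im → ‖deriv f z / f z + Complex.I * ((a * Real.log (‖z‖ + 3) + b : ℝ) : ℂ)‖ ≤ A) →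
    ∀ z : ℂ, f z = 0 → z.im ≠ 0 →
    ∃ (k : ℕ) (α β Y : ℝ), (k : ℝ) ≤ C * Real.log (‖z‖ + 3) ^ 2 ∧
      |α - z.re| ≤ C * Real.log (‖z‖ + 3) ^ 2 ∧ |β - z.re| ≤ C * Real.log (‖z‖ + 3) ^ 2 ∧
      α < β ∧ 0 < Y ∧
      iteratedDeriv k f (α : ℂ) ≠ 0 ∧ iteratedDeriv k f (β : ℂ) ≠ 0 ∧
      deriv (iteratedDeriv k f) (α : ℂ) ≠ 0 ∧ deriv (iteratedDeriv k f) (β : ℂ) ≠ 0 ∧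
      (∃ w : ℂ, iteratedDeriv k f w = 0 ∧ α < w.re ∧ w.re < β ∧ 0 < |w.im| ∧ |w.im| < Y) ∧
      (∀ w : ℂ, deriv (iteratedDeriv k f) w = 0 → α ≤ w.re → w.re ≤ β → |w.im| ≤ Y → w.im = 0) ∧
      (∀ u : ℂ, ((u.im = Y ∧ α ≤ u.re ∧ u.re ≤ β) ∨ ((u.re = α ∨ u.re = β) ∧ 0 < u.im ∧ u.im ≤ Y)) →
        (deriv (iteratedDeriv k f) u / iteratedDeriv k f u).im < 0) := by
  sorry

/-- Registered stub `stub_boxFourierPolya` (= `Sig.stub_boxFourierPolya`, spelled out). -/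
theorem stub_boxFourierPolya :
    ∀ (g : ℂ → ℂ) (α β Y : ℝ), Differentiable ℂ g → (∀ x : ℝ, (g (x : ℂ)).im = 0) → α < β → 0 < Y →
    g (α : ℂ) ≠ 0 → g (β : ℂ) ≠ 0 → deriv g (α : ℂ) ≠ 0 → deriv g (β : ℂ) ≠ 0 →
    (∃ w : ℂ, g w = 0 ∧ α < w.re ∧ w.re < β ∧ 0 < |w.im| ∧ |w.im| < Y) →
    (∀ w : ℂ, deriv g w = 0 → α ≤ w.re → w.re ≤ β → |w.im| ≤ Y → w.im = 0) →
    (∀ u : ℂ, ((u.im = Y ∧ α ≤ u.re ∧ u.re ≤ β) ∨ ((u.re = α ∨ u.re = β) ∧ 0 < u.im ∧ u.im ≤ Y)) →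
      (deriv g u / g u).im < 0) →
    ∃ x : ℝ, α < x ∧ x < β ∧ deriv (fun t : ℝ => (g (t : ℂ)).re) x = 0 ∧ (g (x : ℂ)).re ≠ 0 ∧
      0 ≤ (g (x : ℂ)).re * iteratedDeriv 2 (fun t : ℝ => (g (t : ℂ)).re) x := by
  sorry

/-! ## Glue (proved): real-axis bridge for iterated derivatives -/

/-- `(F^{(k)})'' = F^{(k+2)}` for real functions. [folklore] -/
theorem iteratedDeriv_add_two (F : ℝ → ℝ) (k : ℕ) :
    iteratedDeriv (k + 2) F = iteratedDeriv 2 (iteratedDeriv k F) := by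
  simp only [iteratedDeriv_eq_iterate]
  rw [Nat.add_comm, Function.iterate_add_apply]

/-- **Composition.** The landed box (`Sig.stub_landing`) and the local Fourier–Pólya count on a box
(`Sig.stub_boxFourierPolya`) imply the crux `LogCombLandingLaw`, BY NAME.  Real proof: instantiate the count
at `g = f^{(k)}` (entire and real on `ℝ` by the tree's heredity lemmas), then translate the
conclusion to the real-line iterated derivatives with `KiKim.iteratedDeriv_re_ofReal`. -/
theorem LogCombLandingLaw_of (hL : Sig.stub_landing) (hB : Sig.stub_boxFourierPolya) :
    LogCombLandingLaw := by
  intro A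
  obtain ⟨C, hC⟩ := hL A
  refine ⟨C, ?_⟩
  intro f a b hord hreal heven hstrip ha0 haA hbA hfar z hz hzim
  obtain ⟨k, α, β, Y, hk, hα, hβ, hαβ, hY, hgα, hgβ, hg'α, hg'β, hw, hroots, hsign⟩ :=
    hC f a b hord hreal heven hstrip ha0 haA hbA hfar z hz hzim
  have hf : Differentiable ℂ f := hord.1
  have hgd : Differentiable ℂ (iteratedDeriv k f) :=
    Literature.Analysis.Complex.differentiable_iteratedDeriv_of_entire hf k
  have hgreal : ∀ x : ℝ, (iteratedDeriv k f (x : ℂ)).im = 0 := fun x =>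
    Literature.Analysis.Complex.im_iteratedDeriv_ofReal hf hreal k x
  obtain ⟨x, hαx, hxβ, h1, h2, h3⟩ :=
    hB (iteratedDeriv k f) α β Y hgd hgreal hαβ hY hgα hgβ hg'α hg'β hw hroots hsign
  have hbridge : iteratedDeriv k (fun t : ℝ => (f (t : ℂ)).re) =
      fun t : ℝ => (iteratedDeriv k f (t : ℂ)).re :=
    Literature.Analysis.Complex.KiKim.iteratedDeriv_re_ofReal hf k
  refine ⟨k, x, hk, ?_, ?_, ?_, ?_⟩
  · rw [abs_le] at hα hβ ⊢
    constructor <;> linarith [hα.1, hβ.2]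
  · rw [iteratedDeriv_succ, hbridge]
    exact h1
  · rw [hbridge]
    exact h2
  · rw [iteratedDeriv_add_two, hbridge]
    exact h3

/-- **The skeleton**: the crux BY NAME from the two registered stubs (sorries only inside them). -/
theorem LogCombLandingLaw_proof : LogCombLandingLaw :=
  LogCombLandingLaw_of stub_landing stub_boxFourierPolya

end Summit.RiemannHypothesis.RiemannHypothesis.Cruxes.LogCombLandingLaw.Birth
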